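import Summits.NavierStokesRegularity.NavierStokesRegularity.Theorems.SwirlFreeBudgetEtaLocal
import Summits.NavierStokesRegularity.NavierStokesRegularity.Theorems.SwirlFreeBudgetMeridional
import Summits.NavierStokesRegularity.NavierStokesRegularity.Theorems.AxisymmetricExtremalityAxisymmetricKatoGlobalStubSereginLogSwirlOriginCleanSlabRepr
import Summits.NavierStokesRegularity.NavierStokesRegularity.Theorems.AxisymmetricExtremalityAxisymmetricKatoGlobalStubSeregin2020TypeIISwirlVanishesRepr
import Literature.Analysis.FluidPDE.ConstantinDirectionDissipationCalculus
import HarnessLib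

/-!
# SwirlFreeBudget, toward crux K-18.1 `EtaMoserBound` (T-18.2): the START NORM of the η-Moser
# iteration — `∫∫_{Q(z₁,R₂)} |η|^{2/3} ≤ (2R₂E)^{1/3} (4πR₂⁴)^{2/3}` from the enstrophy alone
# (memo Appendix A.6 at `p = 2/3`, the certified axis kernel) (seat nsreg-p4 g12)

Support file for the DORMANT route `SwirlThreshold` (crux stmt-NavierStokesRegularity-2002) and
planner nsreg-p2's ROUND-18 Appendix A.6: "THE START NORM.  Since `|η|^p = |ω_θ|^p r^{-p}` … by
Hölder with exponents `2/p` and `2/(2-p)` … For `p = 2/3`: `a = 1`, `∫∫_Q r⁻¹ ≤ R₂² · 4πR₂²` (the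
kernel certified in Lean), so `I_{2/3} ≤ (2R₂E₂)^{1/3} (4πR₂⁴)^{2/3} = c E₂^{1/3} R₂³`."
Ingredients: the dictionary `‖curl V‖ = r |η|` on axis-centred balls
(`norm_curl_eq_cylRadius_mul_abs_angVortQuot_of_ball`, g11), `‖curl v‖² ≤ 2|∇v|²_F`
(`norm_curl_sq_le_two_mul_frobeniusNormSq`), Hölder `(3, 3/2)` in `ℝ≥0∞`, the axis kernel
`∫_{B(x₀,ρ)} dx/r ≤ 4πρ²` (`lintegral_ball_inv_cylRadius_le`, S-18.1's lemma), the null axis.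

* `ae_cylRadius_snd_ne_zero` (from the tree's `volume_setOf_cylRadius_snd_eq_zero`),
  `lintegral_parabolicCylinder_snd` (product structure of `Q = I × B`); the tree's
  `cylRadius_sub_of_cylRadius_eq_zero` re-centres the axis kernel;
* `lintegral_rpow_twoThirds_angVortQuot_le` — the start norm bound.

WHAT THIS IS NOT: not NS regularity — measure-theoretic bookkeeping; `EtaMoserBound` stays OPEN; no
crux claim.
-/

namespace Summit.NavierStokesRegularity.NavierStokesRegularity.Theorems.SwirlFreeBudget

open MeasureTheory Set Filter Topology Metric Function
open scoped ENNReal NNReal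
open Literature.Analysis Literature.Analysis.FluidPDE
open Summit.NavierStokesRegularity.NavierStokesRegularity.Theorems.AxisymmetricKatoGlobal.EulerScaling

noncomputable section

/-- Almost every point of space–time is off the axis. -/
theorem ae_cylRadius_snd_ne_zero :
    ∀ᵐ z ∂(volume : Measure (ℝ × EuclideanSpace ℝ (Fin 3))), cylRadius z.2 ≠ 0 := by
  rw [ae_iff]
  simpa using volume_setOf_cylRadius_snd_eq_zero

/-- A parabolic cylinder is the product `]t-r², t[ × B(x, r)`; integrating a function of the
space variable over it gives `r² ∫_{B(x,r)}`. -/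
theorem lintegral_parabolicCylinder_snd {f : EuclideanSpace ℝ (Fin 3) → ℝ≥0∞} (hf : Measurable f)
    (r : ℝ) (z : ℝ × EuclideanSpace ℝ (Fin 3)) :
    ∫⁻ w in parabolicCylinder r z, f w.2 = ENNReal.ofReal (r ^ 2) * ∫⁻ x in ball z.2 r, f x := by
  have e : parabolicCylinder r z = Ioo (z.1 - r ^ 2) z.1 ×ˢ ball z.2 r := rfl
  rw [e, Measure.volume_eq_prod, ← Measure.prod_restrict]
  have h := lintegral_prod_mul (μ := volume.restrict (Ioo (z.1 - r ^ 2) z.1))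
    (ν := volume.restrict (ball z.2 r)) (f := fun _ : ℝ => (1 : ℝ≥0∞)) (g := f)
    aemeasurable_const hf.aemeasurable
  simp only [one_mul, lintegral_const, Measure.restrict_apply MeasurableSet.univ, univ_inter,
    Real.volume_Ioo] at h
  rw [h]
  congr 2
  ring

/-- **The start norm of the η-Moser iteration (memo A.6, `p = 2/3`).**  Let `z₁ = (t₁, x₀)` with
`x₀` on the axis, `R₂ > 0`; let every slice `V t`, `t ∈ ]t₁ - R₂², t₁[`, be `C³` on `B(x₀, R₂)`,
axisymmetric and swirl free (everywhere); let the classical gradient be continuous on `Q(z₁, R₂)`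
and `E(z₁, R₂) ≤ E₂`.  Then `∫∫_{Q(z₁,R₂)} |η|^{2/3} ≤ (2 R₂ E₂)^{1/3} (4π R₂⁴)^{2/3}`
(`= 2^{1/3}(4π)^{2/3} E₂^{1/3} R₂³`). -/
theorem lintegral_rpow_twoThirds_angVortQuot_le
    {V : ℝ → EuclideanSpace ℝ (Fin 3) → EuclideanSpace ℝ (Fin 3)} {z₁ : ℝ × EuclideanSpace ℝ (Fin 3)}
    {R₂ E₂ : ℝ} (hR₂ : 0 < R₂) (haxis : cylRadius z₁.2 = 0)
    (hV3 : ∀ t ∈ Ioo (z₁.1 - R₂ ^ 2) z₁.1, ContDiffOn ℝ 3 (V t) (ball z₁.2 R₂))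
    (hax : ∀ t, IsAxisymmetric (V t)) (hsw : ∀ t, HasNoSwirl (V t))
    (hGc : ContinuousOn (fun z : ℝ × EuclideanSpace ℝ (Fin 3) => fderiv ℝ (V z.1) z.2)
      (parabolicCylinder R₂ z₁))
    (hE₂ : 0 ≤ E₂) (hcknE : cknE R₂ z₁ (fun t x => fderiv ℝ (V t) x) ≤ ENNReal.ofReal E₂) :
    ∫⁻ z in parabolicCylinder R₂ z₁, ‖angVortQuot (V z.1) z.2‖ₑ ^ (2 / 3 : ℝ) ≤
      ENNReal.ofReal ((2 * R₂ * E₂) ^ (1 / 3 : ℝ) * (4 * Real.pi * R₂ ^ 4) ^ (2 / 3 : ℝ)) := by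
  set Q : Set (ℝ × EuclideanSpace ℝ (Fin 3)) := parabolicCylinder R₂ z₁ with hQ
  have hQm : MeasurableSet Q := (isOpen_parabolicCylinder R₂ z₁).measurableSet
  set μ : Measure (ℝ × EuclideanSpace ℝ (Fin 3)) := volume.restrict Q with hμ
  -- the two Hölder factors
  set f : ℝ × EuclideanSpace ℝ (Fin 3) → ℝ≥0∞ := fun z => ‖curl (V z.1) z.2‖ₑ ^ (2 / 3 : ℝ) with hf
  set g : ℝ × EuclideanSpace ℝ (Fin 3) → ℝ≥0∞ :=
    fun z => ENNReal.ofReal ((cylRadius z.2)⁻¹) ^ (2 / 3 : ℝ) with hg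
  -- ### a.e. on `Q`: `|η|^{2/3} = f · g` (dictionary `‖curl V‖ = r |η|` off the axis)
  have hae : ∀ᵐ z ∂μ, ‖angVortQuot (V z.1) z.2‖ₑ ^ (2 / 3 : ℝ) = f z * g z := by
    filter_upwards [ae_restrict_mem hQm, ae_restrict_of_ae (μ := volume) (s := Q) ae_cylRadius_snd_ne_zero]
      with z hz hr
    have hz' := mem_parabolicCylinder.1 hz
    have hdict := norm_curl_eq_cylRadius_mul_abs_angVortQuot_of_ball haxis (hV3 z.1 hz'.1)
      (hax z.1) (hsw z.1) (mem_ball.2 hz'.2)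
    have hrpos : 0 < cylRadius z.2 := (cylRadius_nonneg _).lt_of_ne (Ne.symm hr)
    have heq : |angVortQuot (V z.1) z.2| = ‖curl (V z.1) z.2‖ * (cylRadius z.2)⁻¹ := by
      rw [hdict]; field_simp
    rw [hf, hg, ← ENNReal.mul_rpow_of_nonneg _ _ (by norm_num)]
    congr 1
    rw [Real.enorm_eq_ofReal_abs, heq, ENNReal.ofReal_mul (norm_nonneg _), ofReal_norm]
  -- ### measurability
  have hcurl : ContinuousOn (fun z : ℝ × EuclideanSpace ℝ (Fin 3) => curl (V z.1) z.2) Q := by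
    have e : (fun z : ℝ × EuclideanSpace ℝ (Fin 3) => curl (V z.1) z.2) =
        curlCLM ∘ fun z => fderiv ℝ (V z.1) z.2 := by
      funext z; rfl
    rw [e]
    exact curlCLM.continuous.comp_continuousOn hGc
  have hfm : AEMeasurable f μ :=
    ((hcurl.aestronglyMeasurable hQm).enorm.pow_const _)
  have hgm : AEMeasurable g μ := by
    refine (Measurable.pow_const (ENNReal.measurable_ofReal.comp ?_) _).aemeasurable
    exact (measurable_inv.comp (continuous_cylRadius.measurable.comp measurable_snd))
  -- ### Hölder `(3, 3/2)`
  have hpq : (3 : ℝ).HolderConjugate (3 / 2) := Real.holderConjugate_iff.2 ⟨by norm_num, by norm_num⟩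
  have hH := ENNReal.lintegral_mul_le_Lp_mul_Lq μ hpq hfm hgm
  rw [lintegral_congr_ae hae]
  refine (le_of_eq (by rfl)).trans (hH.trans ?_)
  -- ### the first factor: `∫ f³ = ∫ ‖curl‖² ≤ 2 R₂ E₂`
  have hf3 : ∀ z : ℝ × EuclideanSpace ℝ (Fin 3), f z ^ (3 : ℝ) = ‖curl (V z.1) z.2‖ₑ ^ 2 := by
    intro z
    rw [hf, ← ENNReal.rpow_mul, show (2 / 3 : ℝ) * 3 = 2 by norm_num, ENNReal.rpow_two]
  have hg32 : ∀ z : ℝ × EuclideanSpace ℝ (Fin 3), g z ^ (3 / 2 : ℝ) = ENNReal.ofReal ((cylRadius z.2)⁻¹) := by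
    intro z
    rw [hg, ← ENNReal.rpow_mul, show (2 / 3 : ℝ) * (3 / 2) = 1 by norm_num, ENNReal.rpow_one]
  simp_rw [hf3, hg32]
  have h1 : ∫⁻ z, ‖curl (V z.1) z.2‖ₑ ^ 2 ∂μ ≤ ENNReal.ofReal (2 * R₂ * E₂) := by
    have hpt : ∀ z : ℝ × EuclideanSpace ℝ (Fin 3),
        ‖curl (V z.1) z.2‖ₑ ^ 2 ≤ 2 * ENNReal.ofReal (frobeniusNormSq (fderiv ℝ (V z.1) z.2)) := by
      intro z
      calc ‖curl (V z.1) z.2‖ₑ ^ 2 = ENNReal.ofReal (‖curl (V z.1) z.2‖ ^ 2) := by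
            rw [← ofReal_norm, ENNReal.ofReal_pow (norm_nonneg _)]
        _ ≤ ENNReal.ofReal (2 * frobeniusNormSq (fderiv ℝ (V z.1) z.2)) :=
            ENNReal.ofReal_le_ofReal (norm_curl_sq_le_two_mul_frobeniusNormSq _ _)
        _ = 2 * ENNReal.ofReal (frobeniusNormSq (fderiv ℝ (V z.1) z.2)) := by
            rw [ENNReal.ofReal_mul (by norm_num : (0 : ℝ) ≤ 2), ENNReal.ofReal_ofNat]
    have hJ : ∫⁻ z in Q, ENNReal.ofReal (frobeniusNormSq (fderiv ℝ (V z.1) z.2)) ≤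
        ENNReal.ofReal R₂ * ENNReal.ofReal E₂ := by
      have hR0 : ENNReal.ofReal R₂ ≠ 0 := by rw [ne_eq, ENNReal.ofReal_eq_zero, not_le]; exact hR₂
      calc ∫⁻ z in Q, ENNReal.ofReal (frobeniusNormSq (fderiv ℝ (V z.1) z.2))
          = ENNReal.ofReal R₂ * ((ENNReal.ofReal R₂)⁻¹ *
              ∫⁻ z in Q, ENNReal.ofReal (frobeniusNormSq (fderiv ℝ (V z.1) z.2))) := by
            rw [← mul_assoc, ENNReal.mul_inv_cancel hR0 ENNReal.ofReal_ne_top, one_mul]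
        _ ≤ ENNReal.ofReal R₂ * ENNReal.ofReal E₂ := by
            refine mul_le_mul' le_rfl ?_
            simpa [cknE, hQ] using hcknE
    calc ∫⁻ z, ‖curl (V z.1) z.2‖ₑ ^ 2 ∂μ
        ≤ ∫⁻ z, 2 * ENNReal.ofReal (frobeniusNormSq (fderiv ℝ (V z.1) z.2)) ∂μ := lintegral_mono hpt
      _ = 2 * ∫⁻ z in Q, ENNReal.ofReal (frobeniusNormSq (fderiv ℝ (V z.1) z.2)) := by
          rw [hμ, lintegral_const_mul' _ _ (by norm_num)]
      _ ≤ 2 * (ENNReal.ofReal R₂ * ENNReal.ofReal E₂) := mul_le_mul' le_rfl hJ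
      _ = ENNReal.ofReal (2 * R₂ * E₂) := by
          rw [ENNReal.ofReal_mul (by positivity), ENNReal.ofReal_mul (by norm_num : (0 : ℝ) ≤ 2),
            ENNReal.ofReal_ofNat, mul_assoc]
  -- ### the second factor: `∫_Q dz/r = R₂² ∫_{B} dx/r ≤ 4π R₂⁴`
  have h2 : ∫⁻ z, ENNReal.ofReal ((cylRadius z.2)⁻¹) ∂μ ≤ ENNReal.ofReal (4 * Real.pi * R₂ ^ 4) := by
    have hmeas : Measurable fun x : EuclideanSpace ℝ (Fin 3) => ENNReal.ofReal ((cylRadius x)⁻¹) :=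
      ENNReal.measurable_ofReal.comp (measurable_inv.comp continuous_cylRadius.measurable)
    rw [hμ, hQ, lintegral_parabolicCylinder_snd hmeas R₂ z₁]
    have hker := lintegral_ball_inv_cylRadius_le z₁.2 hR₂
    simp_rw [cylRadius_sub_of_cylRadius_eq_zero haxis] at hker
    calc ENNReal.ofReal (R₂ ^ 2) * ∫⁻ x in ball z₁.2 R₂, ENNReal.ofReal ((cylRadius x)⁻¹)
        ≤ ENNReal.ofReal (R₂ ^ 2) * ENNReal.ofReal (4 * Real.pi * R₂ ^ 2) := mul_le_mul' le_rfl hker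
      _ = ENNReal.ofReal (4 * Real.pi * R₂ ^ 4) := by
          rw [← ENNReal.ofReal_mul (by positivity)]; congr 1; ring
  -- ### assemble
  calc (∫⁻ z, ‖curl (V z.1) z.2‖ₑ ^ 2 ∂μ) ^ (1 / (3 : ℝ)) *
        (∫⁻ z, ENNReal.ofReal ((cylRadius z.2)⁻¹) ∂μ) ^ (1 / (3 / 2 : ℝ))
      ≤ ENNReal.ofReal (2 * R₂ * E₂) ^ (1 / (3 : ℝ)) * ENNReal.ofReal (4 * Real.pi * R₂ ^ 4) ^ (1 / (3 / 2 : ℝ)) := by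
        gcongr
    _ = ENNReal.ofReal ((2 * R₂ * E₂) ^ (1 / 3 : ℝ) * (4 * Real.pi * R₂ ^ 4) ^ (2 / 3 : ℝ)) := by
        rw [show (1 : ℝ) / (3 / 2) = 2 / 3 by norm_num,
          ENNReal.ofReal_rpow_of_nonneg (by positivity) (by norm_num),
          ENNReal.ofReal_rpow_of_nonneg (by positivity) (by norm_num), ← ENNReal.ofReal_mul (by positivity)]

end

end Summit.NavierStokesRegularity.NavierStokesRegularity.Theorems.SwirlFreeBudget
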